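import Mathlib
import Literature.Computability.MetaComplexity.MultilinearSigmaPiSigmaRefutation
import HarnessLib

/-!
# Rank bounds for depth-3 identities (Dvir–Shpilka 2007; Saxena–Seshadhri 2013)

A depth-3 circuit `C = Σ_{i=1}^k T_i`, `T_i = Π_{j=1}^d ℓ_{ij}` with LINEAR forms `ℓ_{ij}` (homogeneous setting, wlog by
homogenisation) over a field `𝔽` is a `ΣΠΣ(k,d)` circuit; it is SIMPLE if no nonzero linear form divides all the `T_i`,
MINIMAL if no proper nonempty sub-sum of the terms vanishes, and its RANK `rk(C)` is the rank of the set of all linear forms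
`ℓ_{ij}` viewed as coefficient vectors [Dvir–Shpilka, SICOMP 36 (2007), Def. 1.2–1.4; Saxena–Seshadhri, J. ACM 60 (2013),
Def. 1].  THE RANK BOUND (Saxena–Seshadhri 2013, Thm 5): a simple, minimal `ΣΠΣ(k,d)` circuit computing the zero polynomial
has `rk(C) < 3k²·lg(2d)` over ANY field (and `< 3k²` over `ℝ`); Dvir–Shpilka 2007 had `2^{O(k²)} log^{k−2} d`, Saxena–Seshadhri
2011 `O(k³ log d)`.  Typed here as a NAMED FACT (`depthThree_rankBound`, not proved) over the tree's `ΣΠΣ` vocabulary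
(`Literature.Computability.MetaComplexity.SigmaPiSigma`: a list of product terms, each a list of `AffineForm`s), with `lg(2d)`
weakened to `Nat.log 2 (2d) + 1` and the (implicit) standing assumption `k ≥ 3` made explicit.  Consumers: the bounded top fan-in
sub-rung of crux `OrbitRestorationQP` (Summits, Valiant's hypothesis, line `depth-three-rung`: Karnin–Shpilka rank-distance
clustering of a minimal `ΣΠΣ(k)` circuit of a symmetric polynomial), black-box PIT for `ΣΠΣ(k)` (Karnin–Shpilka 2011).

What is NOT here: the Sylvester–Gallai rank bounds `SG_k(𝔽)` and the structure theorem behind Thm 5 (nucleus identity);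
the real-field bound `3k²`; any proof.
-/

noncomputable section

namespace Literature.Computability.AlgebraicComplexity

open Literature.Computability.MetaComplexity

universe u v

variable {σ : Type u} {K : Type v} [CommRing K]

/-- A `ΣΠΣ` formula is HOMOGENEOUS (in the sense of the depth-3 identity literature) if every affine factor is a linear form:
its constant term vanishes. [cite: SaxenaSeshadhri2013, §1.1] -/
def SigmaPiSigmaIsHomogeneous (F : SigmaPiSigma σ K) : Prop :=
  ∀ t ∈ F, ∀ ℓ ∈ t, ℓ.2 = 0

/-- A `ΣΠΣ` formula is SIMPLE if no nonzero linear form divides (the polynomial of) every product term.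
[cite: SaxenaSeshadhri2013, Definition 1] -/
def SigmaPiSigmaIsSimple (F : SigmaPiSigma σ K) : Prop :=
  ∀ ℓ : AffineForm σ K, ℓ.1 ≠ 0 → ¬ ∀ t ∈ F, AffineForm.toPoly ℓ ∣ SigmaPiSigma.termPoly t

/-- A `ΣΠΣ` formula is MINIMAL if no proper nonempty sub-multiset of its product terms computes the zero polynomial (sub-multisets
of the list of terms are its sublists). [cite: SaxenaSeshadhri2013, Definition 1] -/
def SigmaPiSigmaIsMinimal (F : SigmaPiSigma σ K) : Prop :=
  ∀ G : SigmaPiSigma σ K, G.Sublist F → 0 < G.length → G.length < F.length → SigmaPiSigma.toPoly G ≠ 0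

/-- The RANK of a `ΣΠΣ` formula over a field: the dimension of the span of (the polynomials of) all its affine factors — for a
homogeneous formula, the rank of its linear forms viewed as coefficient vectors. [cite: SaxenaSeshadhri2013, Definition 1] -/
def sigmaPiSigmaRank {K : Type v} [Field K] (F : SigmaPiSigma σ K) : ℕ :=
  Module.finrank K (Submodule.span K {p : MvPolynomial σ K | ∃ t ∈ F, ∃ ℓ ∈ t, p = AffineForm.toPoly ℓ})

/-- **THE RANK BOUND FOR DEPTH-3 IDENTITIES** (Saxena–Seshadhri 2013, Thm 5, "for any `𝔽`, `rk(C) < 3k² lg 2d`"), as a named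
fact: over any field `K` and finitely many variables, a homogeneous `ΣΠΣ(k,d)` formula (`k ≥ 3` product terms, each the product
of exactly `d ≥ 1` linear forms) that is simple and minimal and computes the zero polynomial has rank
`< 3k²·(⌊log₂(2d)⌋ + 1)` (the printed real bound `3k² lg(2d)` rounded up).  Unproved here; `theorem depthThree_rankBound_holds`
would discharge it. [cite: SaxenaSeshadhri2013, Theorem 5] -/
def depthThree_rankBound : Prop :=
  ∀ (K : Type) [Field K] (σ : Type) [Fintype σ] [DecidableEq σ] (F : SigmaPiSigma σ K) (d : ℕ),
    3 ≤ F.length → 1 ≤ d → (∀ t ∈ F, t.length = d) → SigmaPiSigmaIsHomogeneous F →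
      SigmaPiSigma.toPoly F = 0 → SigmaPiSigmaIsSimple F → SigmaPiSigmaIsMinimal F →
        sigmaPiSigmaRank F < 3 * F.length ^ 2 * (Nat.log 2 (2 * d) + 1)

end Literature.Computability.AlgebraicComplexity

end
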